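import Mathlib
import HarnessLib
import Summits.ResolutionOfSingularities.ResolutionOfSingularities.Theorems.WildQuotientsWildQuotientResolutionJordanThreeChartsB
import Summits.ResolutionOfSingularities.ResolutionOfSingularities.Theorems.WildQuotientsWildQuotientResolutionToricExitJordanThreeBrickRegular
import Summits.ResolutionOfSingularities.ResolutionOfSingularities.Theorems.WildQuotientsWildQuotientResolutionBlowupChartStalk
import Summits.ResolutionOfSingularities.ResolutionOfSingularities.Theorems.WildQuotientsWildQuotientResolutionBlowupChartRegularPiece
import Summits.ResolutionOfSingularities.ResolutionOfSingularities.Theorems.WildQuotientsWildQuotientResolutionBlowupLocalExit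
import Literature.AlgebraicGeometry.Resolution.BlowupPrincipalCharts
import Literature.AlgebraicGeometry.Resolution.AffineBlowupAlgebra
import Literature.AlgebraicGeometry.Resolution.BlowupChartRsop

/-!
# N4a (`𝔸ⁿ/(J₃ ⊕ J₂)`) — `Hregb`/`Hregd`: the two K–L charts `V[x_b²]`, `V[x_d²]` of
# `Bl_{(x_a, x_b², x_bx_d, x_d²)} 𝔸ⁿ` are affine spaces

(crux stmt-ResolutionOfSingularities-15640 `WildQuotients.WildQuotientResolution`, line `Sketch`;
post-V5 width target N4a `JordanThreeTwo.jordanThreeTwo_hasResolution` (res-L1-w45c-idea-2 card N;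
res-L1-w45c-plan-1 15:17:58Z «stub-3 = K1/K2», res-L1-w45c-stub-2 PART F scaffold). The
`J₃ ⊕ J₂` twin of RUNG V5 brick B8 (regularity half) `…JordanFiveChartD` (p525059), by stub-2's
presentation engine `JordanThree.isRegularRing_chartRing_of_chartData`. [OURS · L1 W4.5c] — NOT a
statement of any manuscript; replaces the role of no printed item. Def-free.)

`K = ![x_a, x_b², x_bx_d, x_d²]`, `I = (K)`:
* `JordanThreeTwo.isRegularRing_chartRing_bsq` — `(k[x][It])_{(x_b² t)} ≅ k[x][I/x_b²] = k[u, x_b, w, …]`,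
  `u = x_a/x_b²`, `w = x_d/x_b` (chart map `x_a ↦ K₀/K₁`, `x_d ↦ K₂/K₁`, retracted by `x_a ↦ x_ax_b²`,
  `x_d ↦ x_dx_b`; generator ratios `u, 1, w, w²`), a polynomial ring, hence regular;
* `JordanThreeTwo.isRegularRing_chartRing_dsq` — the same for `(k[x][It])_{(x_d² t)}`
  (`x_a ↦ K₀/K₃`, `x_b ↦ K₂/K₃`);
* `JordanThreeTwo.isRegularRing_blowupAlgebra_idealSheaf_K` (`i ∈ {1, 3}`) and the bricks
  **`JordanThreeTwo.isRegularLocalRing_stalk_of_mem_blowupChart`**: every point of `V[K i]`,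
  `i ∈ {1,3}`, of `V = affineBlowup (span K)` has a regular local ring (`Hregb`, `Hregd`).
-/

-- single-problem summit: the doubled namespace component `ResolutionOfSingularities` is forced
set_option linter.dupNamespace false

noncomputable section

open CategoryTheory AlgebraicGeometry TopologicalSpace MvPolynomial IsLocalization HomogeneousLocalization
open Literature.AlgebraicGeometry.Resolution

namespace Summit.ResolutionOfSingularities.ResolutionOfSingularities.Theorems.WildQuotientResolution.JordanThreeTwo

open JordanThree

variable (k : Type) [Field k] (n : ℕ) (a b d : Fin n) (hab : a ≠ b) (had : a ≠ d) (hbd : b ≠ d)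

include hab had hbd in
/-- **Chart `D₊(x_b² t)` of `Bl_{(x_a,x_b²,x_bx_d,x_d²)} 𝔸ⁿ` is regular**: its ring is
`k[x][I/x_b²] = k[u, x_b, w, (x_s)_{s ≠ a,d}]`, `u = x_a/x_b²`, `w = x_d/x_b` — a polynomial ring in
`n` variables. [OURS · L1 W4.5c] [folklore] -/
theorem isRegularRing_chartRing_bsq :
    IsRegularRing (chartRing
      (![X a, X b ^ 2, X b * X d, X d ^ 2] : Fin 4 → MvPolynomial (Fin n) k) 1) := by
  classical
  set c : Fin 4 → MvPolynomial (Fin n) k := ![X a, X b ^ 2, X b * X d, X d ^ 2] with hc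
  have hc0 : c 0 = X a := rfl
  have hc1 : c 1 = X b ^ 2 := rfl
  have hc2 : c 2 = X b * X d := rfl
  have hc3 : c 3 = X d ^ 2 := rfl
  have hba : b ≠ a := fun h => hab h.symm
  have hda : d ≠ a := fun h => had h.symm
  have hdb : d ≠ b := fun h => hbd h.symm
  set L := Localization.Away (c 1)
  set ι := algebraMap (MvPolynomial (Fin n) k) L with hιdef
  have hu : ι (c 1) * Away.invSelf (c 1) = 1 := Away.mul_invSelf (c 1)
  -- the chart map and the substitution
  let Θ : MvPolynomial (Fin n) k →ₐ[k] L :=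
    aeval fun s => if s = a then ι (c 0) * Away.invSelf (c 1)
      else if s = d then ι (c 2) * Away.invSelf (c 1) else ι (X s)
  let ω : MvPolynomial (Fin n) k →ₐ[k] MvPolynomial (Fin n) k :=
    aeval fun s => if s = a then X a * X b ^ 2 else if s = d then X d * X b else X s
  have hΘa : Θ (X a) = ι (c 0) * Away.invSelf (c 1) := by simp [Θ]
  have hΘd : Θ (X d) = ι (c 2) * Away.invSelf (c 1) := by simp [Θ, hda]
  have hΘs : ∀ s, s ≠ a → s ≠ d → Θ (X s) = ι (X s) := fun s hs hs' => by simp [Θ, hs, hs']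
  have hΘb : Θ (X b) = ι (X b) := hΘs b hba hbd
  have hωa : ω (X a) = X a * X b ^ 2 := by simp [ω]
  have hωd : ω (X d) = X d * X b := by simp [ω, hda]
  have hωs : ∀ s, s ≠ a → s ≠ d → ω (X s) = X s := fun s hs hs' => by simp [ω, hs, hs']
  have hωb : ω (X b) = X b := hωs b hba hbd
  have hωc1 : ω (c 1) = c 1 := by rw [hc1, map_pow, hωb]
  have E := fun (A B : MvPolynomial (Fin n) k) (e e' : ℕ) (h : A * c 1 ^ e' = B * c 1 ^ e) =>
    algebraMap_mul_invSelf_pow_eq (c 1) A B e e' h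
  refine isRegularRing_chartRing_of_chartData c 1 ?_ Θ ω ?_ ?_ ?_ ?_ ?_
  · rw [hc1]; exact pow_ne_zero _ (X_ne_zero b)
  · intro s
    by_cases hs : s = a
    · subst hs
      rw [hωa, map_mul, map_pow, hΘa, hΘb]
      have key := E (c 0 * X b ^ 2) (X s) 1 0 (by rw [hc0, hc1]; ring)
      rw [pow_one, pow_zero, mul_one, map_mul, map_pow] at key
      rw [← key]
      ring
    by_cases hs' : s = d
    · subst hs'
      rw [hωd, map_mul, hΘd, hΘb]
      have key := E (c 2 * X b) (X s) 1 0 (by rw [hc2, hc1]; ring)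
      rw [pow_one, pow_zero, mul_one, map_mul] at key
      rw [← key]
      ring
    · rw [hωs s hs hs', hΘs s hs hs']
  · intro s
    by_cases hs : s = a
    · subst hs
      rw [hΘa]
      exact div_mem_blowupAlgebra _ _ (Ideal.mem_span_range_self (f := c) (x := 0))
    by_cases hs' : s = d
    · subst hs'
      rw [hΘd]
      exact div_mem_blowupAlgebra _ _ (Ideal.mem_span_range_self (f := c) (x := 2))
    · rw [hΘs s hs hs']
      exact Subalgebra.algebraMap_mem _ _
  · intro j
    have hl4 : ∀ l : Fin 4, l = 0 ∨ l = 1 ∨ l = 2 ∨ l = 3 := by decide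
    rcases hl4 j with rfl | rfl | rfl | rfl
    · exact ⟨X a, hΘa⟩
    · refine ⟨1, ?_⟩
      rw [map_one, hu]
    · exact ⟨X d, hΘd⟩
    · refine ⟨X d ^ 2, ?_⟩
      have key := E (c 2 ^ 2) (c 3) 2 1 (by rw [hc2, hc3, hc1]; ring)
      rw [pow_one, map_pow] at key
      rw [map_pow, hΘd, mul_pow, ← key]
  · exact ⟨1, 1, by rw [hωc1, mul_one, pow_one]⟩
  · intro s
    by_cases hs : s = a
    · subst hs
      refine ⟨c 0, 1, by rw [hΘa, pow_one], ?_⟩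
      rw [pow_one, hωc1, hc0, hc1, hωa]
    by_cases hs' : s = d
    · subst hs'
      refine ⟨c 2, 1, by rw [hΘd, pow_one], ?_⟩
      rw [pow_one, hωc1, hc2, hc1, map_mul, hωd, hωb]
      ring
    · exact ⟨X s, 0, by rw [hΘs s hs hs', pow_zero, mul_one],
        by rw [pow_zero, mul_one, hωs s hs hs']⟩

include hab had hbd in
/-- **Chart `D₊(x_d² t)` of `Bl_{(x_a,x_b²,x_bx_d,x_d²)} 𝔸ⁿ` is regular**: its ring is
`k[x][I/x_d²] = k[u′, v, x_d, (x_s)_{s ≠ a,b}]`, `u′ = x_a/x_d²`, `v = x_b/x_d` — a polynomial ring in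
`n` variables. [OURS · L1 W4.5c] [folklore] -/
theorem isRegularRing_chartRing_dsq :
    IsRegularRing (chartRing
      (![X a, X b ^ 2, X b * X d, X d ^ 2] : Fin 4 → MvPolynomial (Fin n) k) 3) := by
  classical
  set c : Fin 4 → MvPolynomial (Fin n) k := ![X a, X b ^ 2, X b * X d, X d ^ 2] with hc
  have hc0 : c 0 = X a := rfl
  have hc1 : c 1 = X b ^ 2 := rfl
  have hc2 : c 2 = X b * X d := rfl
  have hc3 : c 3 = X d ^ 2 := rfl
  have hba : b ≠ a := fun h => hab h.symm
  have hda : d ≠ a := fun h => had h.symm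
  have hdb : d ≠ b := fun h => hbd h.symm
  set L := Localization.Away (c 3)
  set ι := algebraMap (MvPolynomial (Fin n) k) L with hιdef
  have hu : ι (c 3) * Away.invSelf (c 3) = 1 := Away.mul_invSelf (c 3)
  let Θ : MvPolynomial (Fin n) k →ₐ[k] L :=
    aeval fun s => if s = a then ι (c 0) * Away.invSelf (c 3)
      else if s = b then ι (c 2) * Away.invSelf (c 3) else ι (X s)
  let ω : MvPolynomial (Fin n) k →ₐ[k] MvPolynomial (Fin n) k :=
    aeval fun s => if s = a then X a * X d ^ 2 else if s = b then X b * X d else X s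
  have hΘa : Θ (X a) = ι (c 0) * Away.invSelf (c 3) := by simp [Θ]
  have hΘb : Θ (X b) = ι (c 2) * Away.invSelf (c 3) := by simp [Θ, hba]
  have hΘs : ∀ s, s ≠ a → s ≠ b → Θ (X s) = ι (X s) := fun s hs hs' => by simp [Θ, hs, hs']
  have hΘd : Θ (X d) = ι (X d) := hΘs d hda hdb
  have hωa : ω (X a) = X a * X d ^ 2 := by simp [ω]
  have hωb : ω (X b) = X b * X d := by simp [ω, hba]
  have hωs : ∀ s, s ≠ a → s ≠ b → ω (X s) = X s := fun s hs hs' => by simp [ω, hs, hs']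
  have hωd : ω (X d) = X d := hωs d hda hdb
  have hωc3 : ω (c 3) = c 3 := by rw [hc3, map_pow, hωd]
  have E := fun (A B : MvPolynomial (Fin n) k) (e e' : ℕ) (h : A * c 3 ^ e' = B * c 3 ^ e) =>
    algebraMap_mul_invSelf_pow_eq (c 3) A B e e' h
  refine isRegularRing_chartRing_of_chartData c 3 ?_ Θ ω ?_ ?_ ?_ ?_ ?_
  · rw [hc3]; exact pow_ne_zero _ (X_ne_zero d)
  · intro s
    by_cases hs : s = a
    · subst hs
      rw [hωa, map_mul, map_pow, hΘa, hΘd]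
      have key := E (c 0 * X d ^ 2) (X s) 1 0 (by rw [hc0, hc3]; ring)
      rw [pow_one, pow_zero, mul_one, map_mul, map_pow] at key
      rw [← key]
      ring
    by_cases hs' : s = b
    · subst hs'
      rw [hωb, map_mul, hΘb, hΘd]
      have key := E (c 2 * X d) (X s) 1 0 (by rw [hc2, hc3]; ring)
      rw [pow_one, pow_zero, mul_one, map_mul] at key
      rw [← key]
      ring
    · rw [hωs s hs hs', hΘs s hs hs']
  · intro s
    by_cases hs : s = a
    · subst hs
      rw [hΘa]
      exact div_mem_blowupAlgebra _ _ (Ideal.mem_span_range_self (f := c) (x := 0))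
    by_cases hs' : s = b
    · subst hs'
      rw [hΘb]
      exact div_mem_blowupAlgebra _ _ (Ideal.mem_span_range_self (f := c) (x := 2))
    · rw [hΘs s hs hs']
      exact Subalgebra.algebraMap_mem _ _
  · intro j
    have hl4 : ∀ l : Fin 4, l = 0 ∨ l = 1 ∨ l = 2 ∨ l = 3 := by decide
    rcases hl4 j with rfl | rfl | rfl | rfl
    · exact ⟨X a, hΘa⟩
    · refine ⟨X b ^ 2, ?_⟩
      have key := E (c 2 ^ 2) (c 1) 2 1 (by rw [hc2, hc3, hc1]; ring)
      rw [pow_one, map_pow] at key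
      rw [map_pow, hΘb, mul_pow, ← key]
    · exact ⟨X b, hΘb⟩
    · refine ⟨1, ?_⟩
      rw [map_one, hu]
  · exact ⟨1, 1, by rw [hωc3, mul_one, pow_one]⟩
  · intro s
    by_cases hs : s = a
    · subst hs
      refine ⟨c 0, 1, by rw [hΘa, pow_one], ?_⟩
      rw [pow_one, hωc3, hc0, hc3, hωa]
    by_cases hs' : s = b
    · subst hs'
      refine ⟨c 2, 1, by rw [hΘb, pow_one], ?_⟩
      rw [pow_one, hωc3, hc2, hc3, map_mul, hωb, hωd]
      ring
    · exact ⟨X s, 0, by rw [hΘs s hs hs', pow_zero, mul_one],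
        by rw [pow_zero, mul_one, hωs s hs hs']⟩

include hab had hbd in
/-- **The affine blowup algebras of the two K–L charts are regular rings**:
`Γ(𝔸ⁿ, ⊤)[K̃(⊤)/K_i] ≅ k[x][I/K_i] ≅ (k[x][It])_{(K_i t)}` for `i ∈ {1, 3}`.
[OURS · L1 W4.5c] [folklore; assembly of landed decls] -/
theorem isRegularRing_blowupAlgebra_idealSheaf_K (i : Fin 4) (hi : i = 1 ∨ i = 3) :
    IsRegularRing (blowupAlgebra
      ((affineBlowup.idealSheaf (Ideal.span (Set.range
        (![X a, X b ^ 2, X b * X d, X d ^ 2] : Fin 4 → MvPolynomial (Fin n) k)))).ideal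
          ⟨⊤, isAffineOpen_top _⟩)
      ((Scheme.ΓSpecIso (CommRingCat.of (MvPolynomial (Fin n) k))).inv.hom
        ((![X a, X b ^ 2, X b * X d, X d ^ 2] : Fin 4 → MvPolynomial (Fin n) k) i))) := by
  have hxi : (![X a, X b ^ 2, X b * X d, X d ^ 2] : Fin 4 → MvPolynomial (Fin n) k) i ∈
      Ideal.span (Set.range (![X a, X b ^ 2, X b * X d, X d ^ 2] : Fin 4 → MvPolynomial (Fin n) k)) :=
    Ideal.mem_span_range_self (f := (![X a, X b ^ 2, X b * X d, X d ^ 2] :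
      Fin 4 → MvPolynomial (Fin n) k)) (x := i)
  haveI : IsRegularRing (chartRing
      (![X a, X b ^ 2, X b * X d, X d ^ 2] : Fin 4 → MvPolynomial (Fin n) k) i) := by
    rcases hi with rfl | rfl
    · exact isRegularRing_chartRing_bsq k n a b d hab had hbd
    · exact isRegularRing_chartRing_dsq k n a b d hab had hbd
  have h1 : IsRegularRing (blowupAlgebra
      (Ideal.span (Set.range (![X a, X b ^ 2, X b * X d, X d ^ 2] : Fin 4 → MvPolynomial (Fin n) k)))
      ((![X a, X b ^ 2, X b * X d, X d ^ 2] : Fin 4 → MvPolynomial (Fin n) k) i)) :=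
    IsRegularRing.of_ringEquiv
      (R := chartRing (![X a, X b ^ 2, X b * X d, X d ^ 2] : Fin 4 → MvPolynomial (Fin n) k) i)
      (reesChartEquiv _ hxi)
  have h2 := BlowupExit.isRegularRing_blowupAlgebra_map_of_ringEquiv
    (Scheme.ΓSpecIso (CommRingCat.of (MvPolynomial (Fin n) k))).commRingCatIsoToRingEquiv.symm
    (Scheme.ΓSpecIso (CommRingCat.of (MvPolynomial (Fin n) k))).inv.hom (fun _ => rfl)
    _ _ h1
  have hIdeal : (affineBlowup.idealSheaf (Ideal.span (Set.range
      (![X a, X b ^ 2, X b * X d, X d ^ 2] : Fin 4 → MvPolynomial (Fin n) k)))).ideal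
        ⟨⊤, isAffineOpen_top _⟩ =
      (Ideal.span (Set.range (![X a, X b ^ 2, X b * X d, X d ^ 2] :
        Fin 4 → MvPolynomial (Fin n) k))).map
        (Scheme.ΓSpecIso (CommRingCat.of (MvPolynomial (Fin n) k))).inv.hom := by
    change (Scheme.IdealSheafData.ofIdealTop _).ideal ⟨⊤, isAffineOpen_top _⟩ = _
    rw [ideal_ofIdealTop_top]
  rw [hIdeal]
  exact h2

include hab had hbd in
/-- **Bricks `Hregb`/`Hregd`**: every point of the K–L charts `V[x_b²]` (`i = 1`) and `V[x_d²]`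
(`i = 3`) of `V = affineBlowup (x_a, x_b², x_bx_d, x_d²)` has a regular local ring.
[OURS · L1 W4.5c] [folklore; assembly of landed decls] -/
theorem isRegularLocalRing_stalk_of_mem_blowupChart (i : Fin 4) (hi : i = 1 ∨ i = 3) :
    ∀ v ∈ blowupChart (affineBlowup.π (Ideal.span (Set.range
        (![X a, X b ^ 2, X b * X d, X d ^ 2] : Fin 4 → MvPolynomial (Fin n) k))))
      (affineBlowup.idealSheaf (Ideal.span (Set.range
        (![X a, X b ^ 2, X b * X d, X d ^ 2] : Fin 4 → MvPolynomial (Fin n) k))))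
      ⟨⊤, isAffineOpen_top _⟩
      ((Scheme.ΓSpecIso (CommRingCat.of (MvPolynomial (Fin n) k))).inv.hom
        ((![X a, X b ^ 2, X b * X d, X d ^ 2] : Fin 4 → MvPolynomial (Fin n) k) i)),
      IsRegularLocalRing ((affineBlowup (Ideal.span (Set.range
        (![X a, X b ^ 2, X b * X d, X d ^ 2] : Fin 4 → MvPolynomial (Fin n) k)))).presheaf.stalk v) := by
  intro v hv
  have hIdeal : (affineBlowup.idealSheaf (Ideal.span (Set.range
      (![X a, X b ^ 2, X b * X d, X d ^ 2] : Fin 4 → MvPolynomial (Fin n) k)))).ideal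
        ⟨⊤, isAffineOpen_top _⟩ =
      (Ideal.span (Set.range (![X a, X b ^ 2, X b * X d, X d ^ 2] :
        Fin 4 → MvPolynomial (Fin n) k))).map
        (Scheme.ΓSpecIso (CommRingCat.of (MvPolynomial (Fin n) k))).inv.hom := by
    change (Scheme.IdealSheafData.ofIdealTop _).ideal ⟨⊤, isAffineOpen_top _⟩ = _
    rw [ideal_ofIdealTop_top]
  have hxi : (Scheme.ΓSpecIso (CommRingCat.of (MvPolynomial (Fin n) k))).inv.hom
      ((![X a, X b ^ 2, X b * X d, X d ^ 2] : Fin 4 → MvPolynomial (Fin n) k) i) ∈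
      (affineBlowup.idealSheaf (Ideal.span (Set.range
        (![X a, X b ^ 2, X b * X d, X d ^ 2] : Fin 4 → MvPolynomial (Fin n) k)))).ideal
          ⟨⊤, isAffineOpen_top _⟩ := by
    rw [hIdeal]
    exact Ideal.mem_map_of_mem _ (Ideal.mem_span_range_self
      (f := (![X a, X b ^ 2, X b * X d, X d ^ 2] : Fin 4 → MvPolynomial (Fin n) k)) (x := i))
  exact BlowupExit.isRegularLocalRing_stalk_of_mem _
    (BlowupExit.isRegular_blowupChart_of_isRegularRing (affineBlowup.isBlowup _)
      ⟨⊤, isAffineOpen_top _⟩ hxi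
      (isRegularRing_blowupAlgebra_idealSheaf_K k n a b d hab had hbd i hi))
    v hv

end Summit.ResolutionOfSingularities.ResolutionOfSingularities.Theorems.WildQuotientResolution.JordanThreeTwo

end
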